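import Summits.BirchSwinnertonDyer.Rank1Residual.Additive.CyclotomicThreeSplitMultiplicativeReduction
import Summits.BirchSwinnertonDyer.Rank1Residual.Additive.CyclotomicPrimeReduction
import HarnessLib

/-!
# `ℚ(ζ_p)`-side reduction data at a MULTIPLICATIVE prime `p` (any odd `p`): the unique prime `𝔭`
# of `F = ℚ(ζ_p)` over `p`, `V ⊗ F` minimal and multiplicative there, split/non-split preserved
# (prerequisite of line V19b of the cell `b2b-bsdres`, seat additive-p4)

HONEST FRAMING (cell `b2b-bsdres`, run/shared/lean/b2b/bsd-rank1-residual/, verbatim in every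
file): the goal of the cell is to DELETE the COMBINATION-SHAPED residual classes of the
Birch–Swinnerton-Dyer formula for ALL analytic-rank `≤ 1` elliptic curves over `ℚ` — "full BSD
formula for every rank `≤ 1` curve in class `C`" assembled STRICTLY from published theorems — so
that the rank-`≤ 1` remainder becomes exactly the CONSTRUCTION-SHAPED classes, which are TYPED
(missing-input `Prop`s), NOT attempted. This is not "finishing BSD". Seat additive-p4 (research route
on X3/X4); no label moves; nothing is booked here.

Theorems only (no `def`, no `sorry`, no named fact). The `p`-general twins of the `p = 3` lemmas of
`CyclotomicThreeMultiplicativeReduction` / `CyclotomicThreeSplitMultiplicativeReduction` (line V15/V16):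
for `V/ℚ` globally minimal with MULTIPLICATIVE reduction at `p` and a place `𝔭` of a number field `K`
with `p ∈ 𝔭`, `N(𝔭) = p` (e.g. `K = ℚ(ζ_p)`, `𝔭 = (ζ_p − 1)`): `V_K` is non-split at `𝔭` if `V` is
non-split at `p`, and split at `𝔭` if `V` is split at `p` (residue field `k_𝔭 ≃ ℤ/p`, model
independence, the node-tangent quadratic of `V_ℤ`). Packaged for `K = ℚ(ζ_p)`
(`exists_unique_prime_mult_reduction_data`): the unique prime over `p`, `V ⊗ K` minimal and
multiplicative there with the same splitting type — the `K`-side input of Greenberg's multiplicative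
displays over `F = ℚ(ζ_p)` (`Greenberg1999.thm41Analogue_charValue_rankZero_numberField.of_unique_prime_nonsplit`)
for the (M)-rows of X3/X4 at `p ≥ 5` (line V19b, designed; see HOME/b2b-bsdres-additive-p4/REPAIR-CENSUS.md).

References: Silverman, *AEC* VII.1 Prop. 1.3(b), VII.5 Prop. 5.1(b); Washington, *Cyclotomic Fields*, Ch. 2
(`p` totally ramified in `ℚ(ζ_p)`).
-/

noncomputable section

open scoped Classical NumberField

open WeierstrassCurve IsDedekindDomain IsDedekindDomain.HeightOneSpectrum NumberField
  Literature.NumberTheory.EllipticCurves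

namespace Summit.BirchSwinnertonDyer.Rank1Residual.Additive

section BaseChange

variable {K : Type} [Field K] [NumberField K]
  (V : WeierstrassCurve ℚ) [V.IsElliptic] [V.IsGloballyMinimal] (p : ℕ) [hp : Fact p.Prime]

/-- **Non-split stays non-split at a place of residue degree one** (`p`-general twin of
`not_hasSplitMultiplicativeReductionAt_baseChange_of_not_split`): for `V/ℚ` globally minimal with
NON-split multiplicative reduction at `p` and a place `𝔭` of `K` with `p ∈ 𝔭`, `N(𝔭) = p`, `V_K` does
not have split multiplicative reduction at `𝔭` (the node-tangent quadratic of `V_ℤ ⊗ 𝒪_𝔭` is that of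
`V_ℤ` mapped to `k_𝔭 ≃ ℤ/p`, where it does not split). [cite: SilvermanAEC2009, VII.5 Prop. 5.1(b) and VII.1 Prop. 1.3(b)] -/
theorem not_hasSplitMultiplicativeReductionAt_baseChange_of_not_split_prime
    (𝔭 : HeightOneSpectrum (𝓞 K)) (hmem : ((p : ℕ) : 𝓞 K) ∈ 𝔭.asIdeal)
    (hN : Ideal.absNorm 𝔭.asIdeal = p) (hmult : V.HasMultiplicativeReductionAtPrime p)
    (hns : ¬ V.HasSplitMultiplicativeReductionAtPrime p) :
    ¬ (V.baseChange K).HasSplitMultiplicativeReductionAt 𝔭 := by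
  haveI : (V.baseChange K).IsElliptic := by rw [baseChange]; infer_instance
  set R := 𝔭.adicCompletionIntegers K with hR
  set X : WeierstrassCurve (𝔭.adicCompletion K) := (V.baseChange K).baseChange (𝔭.adicCompletion K)
    with hX
  haveI hmin : X.IsMinimal R :=
    (isMinimalAt_and_hasMultiplicativeReductionAt_baseChange_of_mult V (p := p) hmult 𝔭 hmem).1
  have hΔX : X.Δ ≠ 0 := by
    rw [hX, baseChange, map_Δ, baseChange, map_Δ]
    refine (map_ne_zero _).mpr ((map_ne_zero _).mpr V.isUnit_Δ.ne_zero)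
  obtain ⟨D, hD⟩ : ∃ D : VariableChange (𝔭.adicCompletion K),
      (V.baseChange K).localMinimalModel 𝔭 = D • X := ⟨_, rfl⟩
  -- the integral model of `X` is `V_ℤ ⊗ 𝒪_𝔭`
  have h2 : X.integralModel R = (integralModelInt V).map (Int.castRingHom R) := by
    refine integralModel_eq_of_baseChange_eq _ _ ?_
    rw [hX]
    conv_rhs => rw [← map_integralModelInt V]
    rw [baseChange, baseChange, baseChange, map_map, map_map, map_map]
    exact congrArg (integralModelInt V).map (RingHom.ext_int _ _)
  -- the residue field has `p` elements
  have hk : Nat.card (IsLocalRing.ResidueField R) = p :=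
    natCard_residueField_adicCompletionIntegers_eq_of_absNorm 𝔭 hN
  haveI : Finite (IsLocalRing.ResidueField R) :=
    Nat.finite_of_card_ne_zero (by rw [hk]; exact hp.out.ne_zero)
  letI : Fintype (IsLocalRing.ResidueField R) := Fintype.ofFinite _
  have hcard : Fintype.card (IsLocalRing.ResidueField R) = p := by rw [Fintype.card_eq_nat_card, hk]
  let e : ZMod p ≃+* IsLocalRing.ResidueField R :=
    ZMod.ringEquivOfPrime (IsLocalRing.ResidueField R) hp.out hcard
  intro hsplit
  unfold HasSplitMultiplicativeReductionAt at hsplit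
  rw [hD, hasSplitMultiplicativeReduction_iff_of_isMinimal_of_eq_smul R rfl hΔX,
    hasSplitMultiplicativeReduction_iff] at hsplit
  have hs := hsplit.snd
  rw [h2, nodalTangents_map, Polynomial.map_map] at hs
  have hring : (algebraMap R (IsLocalRing.ResidueField R)).comp (Int.castRingHom R) =
      (e : ZMod p →+* IsLocalRing.ResidueField R).comp (Int.castRingHom (ZMod p)) :=
    RingHom.ext_int _ _
  rw [hring, ← Polynomial.map_map, splits_map_ringEquiv_iff e, ← nodalTangents_map] at hs
  exact not_splits_nodal_of_not_hasSplitMultiplicativeReductionAtPrime V p hmult hns hs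

/-- **Split stays split at a place of residue degree one** (`p`-general twin of
`hasSplitMultiplicativeReductionAt_baseChange_of_split`): for `V/ℚ` globally minimal with SPLIT
multiplicative reduction at `p` and a place `𝔭` of `K` with `p ∈ 𝔭`, `N(𝔭) = p`, `V_K` has split
multiplicative reduction at `𝔭`. [cite: SilvermanAEC2009, VII.5 Prop. 5.1(b) and VII.1 Prop. 1.3(b)] -/
theorem hasSplitMultiplicativeReductionAt_baseChange_of_split_prime
    (𝔭 : HeightOneSpectrum (𝓞 K)) (hmem : ((p : ℕ) : 𝓞 K) ∈ 𝔭.asIdeal)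
    (hN : Ideal.absNorm 𝔭.asIdeal = p) (hsplit : V.HasSplitMultiplicativeReductionAtPrime p) :
    (V.baseChange K).HasSplitMultiplicativeReductionAt 𝔭 := by
  have hmult : V.HasMultiplicativeReductionAtPrime p := hsplit.hasMultiplicativeReductionAtPrime
  set R := 𝔭.adicCompletionIntegers K with hR
  set X : WeierstrassCurve (𝔭.adicCompletion K) := (V.baseChange K).baseChange (𝔭.adicCompletion K)
    with hX
  obtain ⟨hminK, hmultK⟩ :=
    isMinimalAt_and_hasMultiplicativeReductionAt_baseChange_of_mult V (p := p) hmult 𝔭 hmem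
  haveI hmin : X.IsMinimal R := hminK
  have hΔX : X.Δ ≠ 0 := by
    rw [hX, baseChange, map_Δ, baseChange, map_Δ]
    refine (map_ne_zero _).mpr ((map_ne_zero _).mpr V.isUnit_Δ.ne_zero)
  obtain ⟨D, hD⟩ : ∃ D : VariableChange (𝔭.adicCompletion K),
      (V.baseChange K).localMinimalModel 𝔭 = D • X := ⟨_, rfl⟩
  have hmultX : X.HasMultiplicativeReduction R := by
    have h := hmultK
    unfold HasMultiplicativeReductionAt at h
    rw [hD, hasMultiplicativeReduction_iff_of_isMinimal_of_eq_smul R rfl hΔX] at h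
    exact h
  have h2 : X.integralModel R = (integralModelInt V).map (Int.castRingHom R) := by
    refine integralModel_eq_of_baseChange_eq _ _ ?_
    rw [hX]
    conv_rhs => rw [← map_integralModelInt V]
    rw [baseChange, baseChange, baseChange, map_map, map_map, map_map]
    exact congrArg (integralModelInt V).map (RingHom.ext_int _ _)
  have hk : Nat.card (IsLocalRing.ResidueField R) = p :=
    natCard_residueField_adicCompletionIntegers_eq_of_absNorm 𝔭 hN
  haveI : Finite (IsLocalRing.ResidueField R) :=
    Nat.finite_of_card_ne_zero (by rw [hk]; exact hp.out.ne_zero)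
  letI : Fintype (IsLocalRing.ResidueField R) := Fintype.ofFinite _
  have hcard : Fintype.card (IsLocalRing.ResidueField R) = p := by rw [Fintype.card_eq_nat_card, hk]
  let e : ZMod p ≃+* IsLocalRing.ResidueField R :=
    ZMod.ringEquivOfPrime (IsLocalRing.ResidueField R) hp.out hcard
  have hsp := splits_nodal_of_hasSplitMultiplicativeReductionAtPrime V p hsplit
  have hring : (algebraMap R (IsLocalRing.ResidueField R)).comp (Int.castRingHom R) =
      (e : ZMod p →+* IsLocalRing.ResidueField R).comp (Int.castRingHom (ZMod p)) :=
    RingHom.ext_int _ _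
  haveI : (D • X).IsMinimal R := by rw [← hD]; exact instIsMinimalLocalMinimalModel 𝔭 (V.baseChange K)
  unfold HasSplitMultiplicativeReductionAt
  rw [hD, hasSplitMultiplicativeReduction_iff_of_isMinimal_of_eq_smul R rfl hΔX,
    hasSplitMultiplicativeReduction_iff]
  refine ⟨hmultX, ?_⟩
  rw [h2, nodalTangents_map, Polynomial.map_map, hring, ← Polynomial.map_map,
    splits_map_ringEquiv_iff e, ← nodalTangents_map]
  exact hsp

end BaseChange

/-! ## Packaged datum for `K = ℚ(ζ_p)` -/

section Cyclotomic

variable (p : ℕ) [hp : Fact p.Prime] (K : Type) [Field K] [NumberField K]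
  (V : WeierstrassCurve ℚ) [V.IsElliptic] [V.IsGloballyMinimal]

/-- **Packaged `K`-side datum for `K = ℚ(ζ_p)` at a MULTIPLICATIVE prime `p`** (`V/ℚ` globally
minimal): there is a finite place `𝔭` of `K` which is the ONLY place above `p`, with `N(𝔭) = p`, at
which `V ⊗ K` is a minimal model with multiplicative reduction, NON-split iff `V` is non-split at `p`
and split iff `V` is split at `p` — everything the projections
`Greenberg1999.thm41Analogue_charValue_rankZero_numberField.of_unique_prime_nonsplit` (non-split) and
the split display consume. [cite: SilvermanAEC2009, Prop. VII.1.3(b), VII.5.1(b)] -/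
theorem exists_unique_prime_mult_reduction_data [IsCyclotomicExtension {p} ℚ K]
    (hmult : V.HasMultiplicativeReductionAtPrime p) :
    ∃ 𝔭 : HeightOneSpectrum (𝓞 K), ((p : ℕ) : 𝓞 K) ∈ 𝔭.asIdeal ∧
      {v : HeightOneSpectrum (𝓞 K) | ((p : ℕ) : 𝓞 K) ∈ v.asIdeal} = {𝔭} ∧
      Ideal.absNorm 𝔭.asIdeal = p ∧
      (V.baseChange K).IsMinimalAt 𝔭 ∧ (V.baseChange K).HasMultiplicativeReductionAt 𝔭 ∧
      (¬ V.HasSplitMultiplicativeReductionAtPrime p →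
        ¬ (V.baseChange K).HasSplitMultiplicativeReductionAt 𝔭) ∧
      (V.HasSplitMultiplicativeReductionAtPrime p → (V.baseChange K).HasSplitMultiplicativeReductionAt 𝔭) := by
  obtain ⟨𝔭, hmem, huniq, hN⟩ := exists_prime_over_prime p K
  obtain ⟨hmin, hm⟩ := isMinimalAt_and_hasMultiplicativeReductionAt_baseChange_of_mult V (p := p) hmult 𝔭 hmem
  exact ⟨𝔭, hmem, huniq, hN, hmin, hm,
    fun hns ↦ not_hasSplitMultiplicativeReductionAt_baseChange_of_not_split_prime V p 𝔭 hmem hN hmult hns,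
    fun hsp ↦ hasSplitMultiplicativeReductionAt_baseChange_of_split_prime V p 𝔭 hmem hN hsp⟩

end Cyclotomic

end Summit.BirchSwinnertonDyer.Rank1Residual.Additive

end
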